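import Literature.Computability.QuantumComplexity.ExactCompilerDefs
import Literature.Computability.QuantumComplexity.SU2CommutatorTower
import HarnessLib

/-!
# The exact braid compiler: evaluation in `SU(2)` and correctness of the commutator tower

Topic `Literature/Computability/QuantumComplexity`; sequel of `ExactCompilerDefs.lean`. An
`EvalSpec` interprets the `K5` matrices of candidates as elements of `SU(2)` (for the one-qubit
gates: `Matrix.map K5.toComplex`; for the two-qubit gadget sector: the unitarisation `tildeOf`),
multiplicatively and with `tr(ev A) = toComplex(tr A)`, so that the compiler's exact quantity
`tr2 = re2(tr)` is `2 Re tr` of the `SU(2)` element (`toReal_tr2`). We then prove the TOWER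
guarantee used by the reduction (Aharonov–Arad 2011 §3.3 in place of Solovay–Kitaev): if `net`
is a `1/200`-net of `SU(2)` made of well-formed candidates and `c₀` is well formed with chord
`r₀ = ‖1 - ev c₀‖ ∈ (0, 1/2]`, then every level `c_s` of `tower net c₀ S` is well formed and the
chords satisfy `r_{s+1} ∈ [r_s²/2, 2 r_s²]` (`chord_tower_succ`), in particular stay in `(0, 1/2]`
and decrease.

## References

* D. Aharonov, I. Arad, New J. Phys. 13 (2011) 035019, §3.3 [AharonovArad2011].
* C. M. Dawson, M. A. Nielsen, QIC 6 (2006), §4.1 [DawsonNielsen2006].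
-/

noncomputable section

open scoped Matrix.Norms.L2Operator

namespace Literature.Computability.QuantumComplexity

open Matrix Complex QuadraticAlgebra

local notation "SU2" => Matrix.specialUnitaryGroup (Fin 2) ℂ
local notation "M2" => Matrix (Fin 2) (Fin 2) ℂ

namespace ExactCompiler

variable {Γ : Type}

/-- **An evaluation of `K5` matrices in `SU(2)`**: a multiplicative, unital, trace-compatible map
sending every generator matrix into `SU(2)`. [cite: AharonovArad2011, §3.3] -/
structure EvalSpec (Γ : Type) where
  /-- the generator matrices -/
  mat₀ : Γ → Matrix (Fin 2) (Fin 2) K5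
  /-- the interpretation of `K5` matrices -/
  evM : Matrix (Fin 2) (Fin 2) K5 → M2
  evM_mul : ∀ A B, evM (A * B) = evM A * evM B
  evM_one : evM 1 = 1
  trace_evM : ∀ A, (evM A).trace = K5.toComplex A.trace
  mem₀ : ∀ γ, evM (mat₀ γ) ∈ Matrix.specialUnitaryGroup (Fin 2) ℂ

variable (E : EvalSpec Γ)

/-- Products of generator matrices evaluate into `SU(2)`. [folklore] -/
theorem evM_prod_mem (l : List Γ) : E.evM ((l.map E.mat₀).prod) ∈ Matrix.specialUnitaryGroup (Fin 2) ℂ := by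
  induction l with
  | nil => rw [List.map_nil, List.prod_nil, E.evM_one]; exact Submonoid.one_mem _
  | cons γ l ih => rw [List.map_cons, List.prod_cons, E.evM_mul]; exact Submonoid.mul_mem _ (E.mem₀ γ) ih

/-- **The `SU(2)` element of a well-formed candidate.** [cite: AharonovArad2011, §3.3] -/
def evS (a : Cand Γ) (ha : a.WF E.mat₀) : SU2 := ⟨E.evM a.mat, by rw [ha.mat_eq]; exact evM_prod_mem E a.word⟩

/-- Underlying matrix. [folklore] -/
@[simp] theorem coe_evS (a : Cand Γ) (ha : a.WF E.mat₀) : ((evS E a ha : SU2) : M2) = E.evM a.mat := rfl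

/-- `evS` only depends on the candidate. [folklore] -/
theorem evS_congr {a b : Cand Γ} (ha : a.WF E.mat₀) (hb : b.WF E.mat₀) (h : a = b) : evS E a ha = evS E b hb :=
  Subtype.ext (by simp only [coe_evS, h])

/-- `ev (a b) = ev a · ev b`. [folklore] -/
theorem evS_mul (a b : Cand Γ) (ha : a.WF E.mat₀) (hb : b.WF E.mat₀) :
    evS E (a.mul b) (ha.mul hb) = evS E a ha * evS E b hb :=
  Subtype.ext (by simp [E.evM_mul])

/-- `ev (a⁻¹) = (ev a)⁻¹`. [folklore] -/
theorem evS_inv (a : Cand Γ) (ha : a.WF E.mat₀) : evS E a.inv ha.inv = (evS E a ha)⁻¹ := by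
  apply eq_inv_of_mul_eq_one_left
  apply Subtype.ext
  rw [Submonoid.coe_mul, coe_evS, coe_evS, Cand.mat_inv, ← E.evM_mul, ha.inv_mul, E.evM_one]; rfl

/-- `ev (V c V⁻¹) = ev V · ev c · (ev V)⁻¹`. [folklore] -/
theorem evS_conj (V c : Cand Γ) (hV : V.WF E.mat₀) (hc : c.WF E.mat₀) :
    evS E (V.conj c) (hV.conj hc) = evS E V hV * evS E c hc * (evS E V hV)⁻¹ := by
  rw [← evS_inv E V hV, ← evS_mul, ← evS_mul]; rfl

/-- `ev [a, b] = [ev a, ev b]`. [folklore] -/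
theorem evS_gcomm (a b : Cand Γ) (ha : a.WF E.mat₀) (hb : b.WF E.mat₀) :
    evS E (a.gcomm b) (ha.gcomm hb) = gcomm (evS E a ha) (evS E b hb) := by
  rw [gcomm, ← evS_inv E a ha, ← evS_inv E b hb, ← evS_mul, ← evS_mul, ← evS_mul]; rfl

/-- `ev (c^n) = (ev c)^n`. [folklore] -/
theorem evS_pow (c : Cand Γ) (hc : c.WF E.mat₀) : ∀ n, evS E (c.pow n) (hc.pow n) = evS E c hc ^ n
  | 0 => Subtype.ext (by simp [E.evM_one, Cand.pow])
  | n + 1 => by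
    rw [pow_succ, ← evS_pow c hc n, ← evS_mul]; rfl

/-- **The exact trace**: `toReal (tr2 a) = 2 Re tr (ev a)`. [folklore] -/
theorem toReal_tr2 (a : Cand Γ) (ha : a.WF E.mat₀) :
    ZPhiS.toReal a.tr2 = 2 * (((evS E a ha : SU2) : M2).trace).re := by
  rw [Cand.tr2, ← K5.two_mul_re_toComplex, coe_evS, E.trace_evM, Matrix.trace_fin_two]

/-! ### Correctness of the tower -/

/-- The chord of a candidate. [folklore] -/
def chord (a : Cand Γ) (ha : a.WF E.mat₀) : ℝ := ‖(1 : M2) - ((evS E a ha : SU2) : M2)‖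

/-- All elements of a list of candidates are well formed. [folklore] -/
def AllWF (L : List (Cand Γ)) : Prop := ∀ a ∈ L, a.WF E.mat₀

/-- A `1/200`-net of `SU(2)` made of well-formed candidates. [cite: AharonovArad2011, §3.3] -/
def IsNet (net : List (Cand Γ)) : Prop :=
  AllWF E net ∧ ∀ A : SU2, ∃ V, ∃ _ : V ∈ net, ∃ hW : V.WF E.mat₀, ‖(A : M2) - ((evS E V hW : SU2) : M2)‖ ≤ 1 / 200

/-- `towerStep` is well formed. [folklore] -/
theorem wf_towerStep {net : List (Cand Γ)} (hnet : AllWF E net) {c : Cand Γ} (hc : c.WF E.mat₀) :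
    (towerStep net c).WF E.mat₀ := by
  unfold towerStep
  set cands := net.map fun V => c.gcomm (V.conj c) with hcands
  have hall : ∀ x ∈ cands, x.WF E.mat₀ := by
    intro x hx
    obtain ⟨V, hV, rfl⟩ := List.mem_map.1 hx
    exact hc.gcomm ((hnet V hV).conj hc)
  have hd : (cands.headD c).WF E.mat₀ := by
    cases h : cands with
    | nil => simpa using hc
    | cons x t => simpa using hall x (by rw [h]; simp)
  rcases bestBy_mem ZPhiS.lt Cand.tr2 (cands.headD c) cands with h | h
  · rw [h]; exact hd
  · exact hall _ h

/-- **One tower step squares the chord up to constants.** [cite: AharonovArad2011, §3.3] [cite: DawsonNielsen2006, §4.1] -/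
theorem chord_towerStep {net : List (Cand Γ)} (hnet : IsNet E net) (hne : net ≠ []) {c : Cand Γ} (hc : c.WF E.mat₀)
    (hr : chord E c hc ≤ 1) :
    chord E c hc ^ 2 / 2 ≤ chord E (towerStep net c) (wf_towerStep E hnet.1 hc) ∧
      chord E (towerStep net c) (wf_towerStep E hnet.1 hc) ≤ 2 * chord E c hc ^ 2 := by
  -- the angle of `c`
  obtain ⟨R, θ, hθ0, hθπ, hcR⟩ := exists_conj_torus (evS E c hc)
  have hθ : θ ≤ Real.pi / 2 := by
    -- `(2/π) θ ≤ chord ≤ 1`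
    have h1 := mul_abs_le_norm_one_sub_torus (ψ := θ) (by rw [abs_of_nonneg hθ0]; exact hθπ)
    rw [abs_of_nonneg hθ0] at h1
    have h2 : ‖(1 : M2) - ((torus θ : SU2) : M2)‖ = chord E c hc := by
      rw [chord, hcR, norm_one_sub_conj]
    rw [h2] at h1
    have hpi := Real.pi_pos
    have h3 : 2 / Real.pi * θ ≤ 1 := h1.trans hr
    rw [div_mul_eq_mul_div, div_le_iff₀ hpi] at h3
    linarith
  -- the net of `SU(2)` elements
  obtain ⟨hwf, hcover⟩ := hnet
  -- identify `towerStep` with the trace minimiser over the evaluated net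
  unfold towerStep
  set cands := net.map fun V => c.gcomm (V.conj c) with hcands
  set best := bestBy ZPhiS.lt Cand.tr2 (cands.headD c) cands with hbest
  have hbest_mem : best ∈ cands := by
    rcases bestBy_mem ZPhiS.lt Cand.tr2 (cands.headD c) cands with h | h
    · rw [← hbest] at h; rw [h]
      obtain ⟨V₀, t, hVt⟩ := List.exists_cons_of_ne_nil hne
      simp [hcands, hVt]
    · rw [← hbest] at h; exact h
  obtain ⟨Vs, hVs, hVsbest⟩ := List.mem_map.1 hbest_mem
  have hVsW : Vs.WF E.mat₀ := hwf Vs hVs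
  have hbestW : best.WF E.mat₀ := wf_towerStep E hwf hc
  -- the evaluated statement
  have key := chord_gcomm_best (Net := net.attach.map fun V => evS E V.1 (hwf V.1 V.2))
    (c := evS E c hc) (R := R) (θ := θ) (fun A => ?_) hcR hθ0 hθ (Vs := evS E Vs hVsW) ?_
  · -- translate back
    have e1 : gcomm (evS E c hc) (evS E Vs hVsW * evS E c hc * (evS E Vs hVsW)⁻¹) = evS E best hbestW := by
      have : evS E best hbestW = evS E (c.gcomm (Vs.conj c)) (hc.gcomm (hVsW.conj hc)) :=
        Subtype.ext (by simp only [coe_evS]; rw [← hVsbest])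
      rw [this, evS_gcomm E c (Vs.conj c) hc (hVsW.conj hc), evS_conj E Vs c hVsW hc]
    rw [e1] at key
    exact key
  · obtain ⟨V, hV, hW, hVA⟩ := hcover A
    exact ⟨evS E V hW, List.mem_map.2 ⟨⟨V, hV⟩, List.mem_attach _ _, rfl⟩, hVA⟩
  · -- optimality of the trace minimiser
    intro W hW
    obtain ⟨⟨V, hV⟩, -, rfl⟩ := List.mem_map.1 hW
    have hmem : c.gcomm (V.conj c) ∈ cands := List.mem_map.2 ⟨V, hV, rfl⟩
    have hle := (toReal_key_bestBy_le Cand.tr2 (cands.headD c) cands).2 _ hmem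
    rw [← hbest] at hle
    have hW' : (c.gcomm (V.conj c)).WF E.mat₀ := hc.gcomm ((hwf V hV).conj hc)
    rw [toReal_tr2 E best hbestW, toReal_tr2 E _ hW'] at hle
    have e2 : evS E (c.gcomm (V.conj c)) hW' = gcomm (evS E c hc) (evS E V (hwf V hV) * evS E c hc * (evS E V (hwf V hV))⁻¹) := by
      have : evS E (c.gcomm (V.conj c)) hW' = evS E (c.gcomm (V.conj c)) (hc.gcomm ((hwf V hV).conj hc)) := rfl
      rw [this, evS_gcomm E c (V.conj c) hc ((hwf V hV).conj hc), evS_conj E V c (hwf V hV) hc]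
    have e1 : evS E best hbestW = gcomm (evS E c hc) (evS E Vs hVsW * evS E c hc * (evS E Vs hVsW)⁻¹) := by
      have : evS E best hbestW = evS E (c.gcomm (Vs.conj c)) (hc.gcomm (hVsW.conj hc)) :=
        Subtype.ext (by simp only [coe_evS]; rw [← hVsbest])
      rw [this, evS_gcomm E c (Vs.conj c) hc (hVsW.conj hc), evS_conj E Vs c hVsW hc]
    rw [e1, e2] at hle
    linarith

/-! ### Iterating the tower -/

/-- The last level of the tower of depth `S`. [folklore] -/
def towerLast (net : List (Cand Γ)) (c₀ : Cand Γ) (S : ℕ) : Cand Γ := (tower net c₀ S).getLastD c₀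

/-- `towerLast 0 = c₀`. [folklore] -/
theorem towerLast_zero (net : List (Cand Γ)) (c₀ : Cand Γ) : towerLast net c₀ 0 = c₀ := by
  simp [towerLast, tower]

/-- `towerLast (S+1) = towerStep (towerLast S)`. [folklore] -/
theorem towerLast_succ (net : List (Cand Γ)) (c₀ : Cand Γ) (S : ℕ) :
    towerLast net c₀ (S + 1) = towerStep net (towerLast net c₀ S) := by
  simp [towerLast, tower]

/-- The levels of the tower are the `towerLast s`, `s ≤ S`. [folklore] -/
theorem mem_tower_iff (net : List (Cand Γ)) (c₀ : Cand Γ) (S : ℕ) (x : Cand Γ) :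
    x ∈ tower net c₀ S ↔ ∃ s ≤ S, x = towerLast net c₀ s := by
  induction S with
  | zero => simp [tower, towerLast_zero]
  | succ S ih =>
    rw [tower, List.mem_append, ih, List.mem_singleton, ← towerLast, ← towerLast_succ]
    constructor
    · rintro (⟨s, hs, rfl⟩ | rfl)
      · exact ⟨s, by omega, rfl⟩
      · exact ⟨S + 1, le_rfl, rfl⟩
    · rintro ⟨s, hs, rfl⟩
      rcases Nat.lt_or_ge s (S + 1) with h | h
      · exact Or.inl ⟨s, by omega, rfl⟩
      · exact Or.inr (by rw [show s = S + 1 by omega])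

/-- Every level of the tower is well formed. [folklore] -/
theorem wf_towerLast {net : List (Cand Γ)} (hnet : AllWF E net) {c₀ : Cand Γ} (hc₀ : c₀.WF E.mat₀) :
    ∀ S, (towerLast net c₀ S).WF E.mat₀
  | 0 => by rw [towerLast_zero]; exact hc₀
  | S + 1 => by rw [towerLast_succ]; exact wf_towerStep E hnet (wf_towerLast hnet hc₀ S)

/-- The tower is a list of well-formed candidates. [folklore] -/
theorem allWF_tower {net : List (Cand Γ)} (hnet : AllWF E net) {c₀ : Cand Γ} (hc₀ : c₀.WF E.mat₀) (S : ℕ) :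
    AllWF E (tower net c₀ S) := by
  intro x hx
  obtain ⟨s, _, rfl⟩ := (mem_tower_iff net c₀ S x).1 hx
  exact wf_towerLast E hnet hc₀ s

/-- Chords only depend on the matrix. [folklore] -/
theorem chord_congr {a b : Cand Γ} (ha : a.WF E.mat₀) (hb : b.WF E.mat₀) (h : a.mat = b.mat) :
    chord E a ha = chord E b hb := by
  unfold chord; simp only [coe_evS, h]

/-- **The tower invariant**: starting from a chord `r₀ ≤ 1/2`, every chord stays `≤ 1/2`, and
consecutive chords satisfy `r_s²/2 ≤ r_{s+1} ≤ 2 r_s²`; in particular all chords are positive if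
`r₀` is. [cite: AharonovArad2011, §3.3] [cite: DawsonNielsen2006, §4.1] -/
theorem chord_towerLast_succ {net : List (Cand Γ)} (hnet : IsNet E net) (hne : net ≠ []) {c₀ : Cand Γ}
    (hc₀ : c₀.WF E.mat₀) (hr₀ : chord E c₀ hc₀ ≤ 1 / 2) (S : ℕ) :
    chord E (towerLast net c₀ S) (wf_towerLast E hnet.1 hc₀ S) ≤ 1 / 2 ∧
      chord E (towerLast net c₀ S) (wf_towerLast E hnet.1 hc₀ S) ^ 2 / 2 ≤
          chord E (towerLast net c₀ (S + 1)) (wf_towerLast E hnet.1 hc₀ (S + 1)) ∧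
        chord E (towerLast net c₀ (S + 1)) (wf_towerLast E hnet.1 hc₀ (S + 1)) ≤
          2 * chord E (towerLast net c₀ S) (wf_towerLast E hnet.1 hc₀ S) ^ 2 := by
  induction S with
  | zero =>
    have e0 : chord E (towerLast net c₀ 0) (wf_towerLast E hnet.1 hc₀ 0) = chord E c₀ hc₀ :=
      chord_congr E _ _ (by rw [towerLast_zero])
    have h := chord_towerStep E hnet hne (wf_towerLast E hnet.1 hc₀ 0) (by rw [e0]; linarith)
    have e1 : chord E (towerLast net c₀ 1) (wf_towerLast E hnet.1 hc₀ 1) =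
        chord E (towerStep net (towerLast net c₀ 0)) (wf_towerStep E hnet.1 (wf_towerLast E hnet.1 hc₀ 0)) :=
      chord_congr E _ _ (by rw [show (1 : ℕ) = 0 + 1 from rfl, towerLast_succ])
    rw [e1, e0] at *
    rw [e0] at h
    exact ⟨hr₀, h.1, h.2⟩
  | succ S ih =>
    obtain ⟨hS, hlo, hhi⟩ := ih
    have hS1 : chord E (towerLast net c₀ (S + 1)) (wf_towerLast E hnet.1 hc₀ (S + 1)) ≤ 1 / 2 := by
      have hnn := norm_nonneg ((1 : M2) - ((evS E (towerLast net c₀ S) (wf_towerLast E hnet.1 hc₀ S) : SU2) : M2))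
      change 0 ≤ chord E (towerLast net c₀ S) (wf_towerLast E hnet.1 hc₀ S) at hnn
      nlinarith
    have h := chord_towerStep E hnet hne (wf_towerLast E hnet.1 hc₀ (S + 1)) (by linarith)
    have e1 : chord E (towerLast net c₀ (S + 1 + 1)) (wf_towerLast E hnet.1 hc₀ (S + 1 + 1)) =
        chord E (towerStep net (towerLast net c₀ (S + 1))) (wf_towerStep E hnet.1 (wf_towerLast E hnet.1 hc₀ (S + 1))) :=
      chord_congr E _ _ (by rw [towerLast_succ])
    rw [e1]
    exact ⟨hS1, h.1, h.2⟩

/-- **All tower chords are positive and at most `1/2`** (given `0 < r₀ ≤ 1/2`). [cite: AharonovArad2011, §3.3] -/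
theorem chord_towerLast_pos {net : List (Cand Γ)} (hnet : IsNet E net) (hne : net ≠ []) {c₀ : Cand Γ}
    (hc₀ : c₀.WF E.mat₀) (hr₀ : chord E c₀ hc₀ ≤ 1 / 2) (hpos : 0 < chord E c₀ hc₀) :
    ∀ S, 0 < chord E (towerLast net c₀ S) (wf_towerLast E hnet.1 hc₀ S) ∧
      chord E (towerLast net c₀ S) (wf_towerLast E hnet.1 hc₀ S) ≤ 1 / 2
  | 0 => by
    have e0 : chord E (towerLast net c₀ 0) (wf_towerLast E hnet.1 hc₀ 0) = chord E c₀ hc₀ :=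
      chord_congr E _ _ (by rw [towerLast_zero])
    rw [e0]; exact ⟨hpos, hr₀⟩
  | S + 1 => by
    obtain ⟨hp, _⟩ := chord_towerLast_pos hnet hne hc₀ hr₀ hpos S
    obtain ⟨_, hlo, _⟩ := chord_towerLast_succ E hnet hne hc₀ hr₀ S
    obtain ⟨hle, _, _⟩ := chord_towerLast_succ E hnet hne hc₀ hr₀ (S + 1)
    exact ⟨by nlinarith, hle⟩

end ExactCompiler

end Literature.Computability.QuantumComplexity

end
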